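import Literature.Geometry.Riemannian.AlmostNonnegativeCurvatureSmoothingProofs
import Literature.Geometry.Riemannian.ConstantCurvature
import Literature.Geometry.Lorentzian.IsometryProofs
import Literature.Geometry.Lorentzian.LeviCivitaProofs
import Literature.Geometry.Lorentzian.LeviCivitaCurvature
import Mathlib.Geometry.Manifold.LocalDiffeomorph
import HarnessLib

/-!
# Transport of the compact constant-curvature blow-up limit back to `M`
(stub `stub_transfer` of line `margerin-cone-hamilton-rails`, crux
`EntropyRung.ChangGurskyYang`, item stmt-SmoothPoincare4-10834)

STUB 4f of the line (last step of the blow-up / round-limit endgame for STUB 4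
`stub_pinchedFlowConvergence`). The pointed Cheeger–Gromov limit `(N, h)` of the rescaled flow on
the closed connected 4-manifold `M` comes with an increasing open exhaustion `U n` of `N` and
comparison maps `φ n : N → M` which are injective `C^∞` local diffeomorphisms ON `U n`
(Morgan–Tian 2007, Def. 5.3). When `N` is COMPACT (stub `stub_roundRecognition`) and `h` has
constant sectional curvature `k`, the metric is transported to `M`:

1. `N` compact, `U n` open and increasing with `⋃ U n = N` ⇒ `U n = N` for some `n`
   (`IsCompact.elim_directed_cover`);
2. then `φ n` is an injective `C^∞` local diffeomorphism of all of `N`; its range is open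
   (invariance of domain for local diffeomorphisms, `IsLocalDiffeomorph.isOpen_range`) and compact,
   hence closed in the Hausdorff space `M`, hence all of the connected space `M`
   (`IsClopen.eq_univ`); so `φ n` is bijective and `IsLocalDiffeomorph.diffeomorphOfBijective`
   makes it a diffeomorphism `Φ : N ≃ₘ M`;
3. `g' := (Φ⁻¹)^* h` (`PseudoRiemannianMetric.comap`, smoothness of the pullback
   `contMDiff_pullbackBilin_holds`) is Riemannian (`IsRiemannian.comap`) and has constant sectional
   curvature `k`, because local isometries preserve the curvature tensor (O'Neill 1983, Ch. 3,
   Prop. 3.59 = the tree's `riemann_comap_apply` / `curvatureForm_comap_leviCivita`):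
   `hasConstantSectionalCurvature_comap` below, the companion of the tree's
   `hasConstantSectionalCurvature_of_comap_of_surjective` (`ConstantCurvatureDescent.lean`) in the
   easy direction.

References: B. O'Neill, *Semi-Riemannian geometry* (1983), Ch. 3, Prop. 3.59, Cor. 3.60–3.61
[ONeill1983]; J. M. Lee, *Introduction to Riemannian Manifolds*, 2nd ed. (2018), Prop. 8.36
[Lee2018]; J. Morgan, G. Tian, *Ricci flow and the Poincaré conjecture* (2007), Def. 5.3
[MorganTian2007].
-/

noncomputable section

-- every `Summit.SmoothPoincare4.SmoothPoincare4.…` name repeats the summit = sub-problem segment (D-0017 layout)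
set_option linter.dupNamespace false

open Set Function Module
open scoped Manifold ContDiff Topology

namespace Summit.SmoothPoincare4.SmoothPoincare4.Theorems.MargerinRails

open Literature.Geometry.Riemannian
open Literature.Geometry.Lorentzian Literature.Geometry.Lorentzian.PseudoRiemannianMetric

/-! ## Constant sectional curvature pulls back along equidimensional immersions -/

section Comap

variable {E : Type*} [NormedAddCommGroup E] [NormedSpace ℝ E] {H : Type*} [TopologicalSpace H]
  {I : ModelWithCorners ℝ E H} {M : Type*} [TopologicalSpace M] [ChartedSpace H M]
  [IsManifold I ∞ M]
  {E' : Type*} [NormedAddCommGroup E'] [NormedSpace ℝ E'] {H' : Type*} [TopologicalSpace H']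
  {I' : ModelWithCorners ℝ E' H'} {N : Type*} [TopologicalSpace N] [ChartedSpace H' N]
  [IsManifold I' ∞ N]
  [FiniteDimensional ℝ E] [FiniteDimensional ℝ E'] [CompleteSpace E] [CompleteSpace E']
  (g : PseudoRiemannianMetric I ∞ E (TangentSpace I : M → Type _))
  {Φ : N → M} (hpb : contMDiff_pullbackBilin I M I' N ∞) (hΦ : ContMDiff I' I (∞ + 1) Φ)
  (hΦ' : ∀ u, Function.Injective (mfderiv I' I Φ u))
  (hdim : Module.finrank ℝ E' = Module.finrank ℝ E)

/-- **Constant sectional curvature is preserved by pullback along a local isometry** (O'Neill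
1983, Ch. 3, Prop. 3.59: local isometries preserve the curvature tensor; Lee 2018, Prop. 8.36 for
the words). If `Φ : N → M` is an equidimensional `C^∞` immersion and `g` has constant sectional
curvature `c`, then so has `Φ^*g = g.comap … Φ …`: for every Levi-Civita connection `cov` of
`Φ^*g`, `Rm^{Φ^*g, cov} = Rm^{Φ^*g}` (`IsLeviCivita.curvature_eq_riemann`), and
`Rm^{Φ^*g}_u(X, Y, Z, W) = Rm^g_{Φ u}(dΦ X, dΦ Y, dΦ Z, dΦ W)`
(`curvatureForm_comap_leviCivita`, from `riemann_comap_apply`), while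
`(Φ^*g)_u(X, Y) = g_{Φ u}(dΦ X, dΦ Y)` by definition.
[cite: ONeill1983, Ch. 3, Prop. 3.59] -/
theorem hasConstantSectionalCurvature_comap {c : ℝ} (h : g.HasConstantSectionalCurvature c) :
    (g.comap hpb Φ hΦ hΦ' hdim).HasConstantSectionalCurvature c := by
  intro cov hcov
  haveI := g.hasLeviCivita
  haveI := (g.comap hpb Φ hΦ hΦ' hdim).hasLeviCivita
  have h2 : (2 : ℕ∞ω) ≤ ∞ := WithTop.coe_le_coe.mpr le_top
  intro u X Y Z W
  have hLC :
      (g.comap hpb Φ hΦ hΦ' hdim).IsLeviCivita (g.comap hpb Φ hΦ hΦ' hdim).leviCivita :=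
    isLeviCivita_leviCivita_holds (g := g.comap hpb Φ hΦ hΦ' hdim)
  have hcf : (g.comap hpb Φ hΦ hΦ' hdim).curvatureForm cov u X Y Z W =
      (g.comap hpb Φ hΦ hΦ' hdim).curvatureForm (g.comap hpb Φ hΦ hΦ' hdim).leviCivita
        u X Y Z W := by
    rw [curvatureForm, curvatureForm, hcov.curvature_eq_riemann h2, hLC.curvature_eq_riemann h2]
  rw [hcf, g.curvatureForm_comap_leviCivita hpb hΦ hΦ' hdim u X Y Z W,
    (h _ (isLeviCivita_leviCivita_holds (g := g))).curvatureForm_eq]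
  simp only [val_comap, Literature.Geometry.Lorentzian.pullbackBilin_apply]

end Comap

/-! ## An increasing open exhaustion of a compact space stabilises -/

/-- On a compact space an increasing sequence of open sets covering the space is eventually the
whole space (a finite subcover of a directed cover is dominated by one member). [folklore] -/
theorem exists_eq_univ_of_monotone_iUnion_eq_univ {X : Type*} [TopologicalSpace X]
    [CompactSpace X] {U : ℕ → Set X} (hUo : ∀ n, IsOpen (U n)) (hmono : Monotone U)
    (hcov : (⋃ n, U n) = univ) : ∃ n, U n = univ := by
  have hdir : Directed (· ⊆ ·) U := fun i j ↦
    ⟨max i j, hmono (le_max_left i j), hmono (le_max_right i j)⟩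
  obtain ⟨n, hn⟩ := isCompact_univ.elim_directed_cover U hUo hcov.symm.subset hdir
  exact ⟨n, eq_univ_of_univ_subset hn⟩

/-! ## A local diffeomorphism of a compact manifold into a connected one is onto -/

section Diffeo

variable {E : Type*} [NormedAddCommGroup E] [NormedSpace ℝ E] {H : Type*} [TopologicalSpace H]
  {I : ModelWithCorners ℝ E H} {M : Type*} [TopologicalSpace M] [ChartedSpace H M]
  {E' : Type*} [NormedAddCommGroup E'] [NormedSpace ℝ E'] {H' : Type*} [TopologicalSpace H']
  {I' : ModelWithCorners ℝ E' H'} {N : Type*} [TopologicalSpace N] [ChartedSpace H' N]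
  {n : ℕ∞ω}

/-- **A local diffeomorphism from a nonempty compact space to a connected Hausdorff space is
surjective**: its range is open (local diffeomorphisms are open maps) and compact, hence closed,
hence everything. [folklore] -/
theorem surjective_of_isLocalDiffeomorph [CompactSpace N] [Nonempty N] [T2Space M]
    [ConnectedSpace M] {f : N → M} (hf : IsLocalDiffeomorph I' I n f) : Surjective f := by
  have hclopen : IsClopen (range f) :=
    ⟨(isCompact_range hf.contMDiff.continuous).isClosed, hf.isOpen_range⟩
  exact range_eq_univ.mp (hclopen.eq_univ (range_nonempty f))

end Diffeo

/-! ## The stub -/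

/-- **STUB 4f — TRANSPORT OF THE COMPACT CONSTANT-CURVATURE LIMIT TO `M`.** If the pointed limit
`(N, h)` (Riemannian, constant sectional curvature `k`) of the blow-up sequence is compact, then
the exhaustion `U n` (open, increasing, `⋃ U n = N`) stabilises at some `U n = N`
(`exists_eq_univ_of_monotone_iUnion_eq_univ`), the comparison map `φ n : N → M` is then an
injective `C^∞` local diffeomorphism of all of `N`
(`isLocalDiffeomorph_iff_isLocalDiffeomorphOn_univ`) onto an open-and-compact, hence clopen,
hence total subset of the connected Hausdorff `M`
(`surjective_of_isLocalDiffeomorph`), so a diffeomorphism `Φ : N ≃ₘ M`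
(`IsLocalDiffeomorph.diffeomorphOfBijective`), and `g' := (Φ⁻¹)^* h`
(`PseudoRiemannianMetric.comap`, `contMDiff_pullbackBilin_holds`) is a Riemannian metric on `M`
(`IsRiemannian.comap`) of constant sectional curvature `k` (`hasConstantSectionalCurvature_comap`,
O'Neill 1983, Ch. 3, Prop. 3.59). [cite: ONeill1983, Ch. 3, Prop. 3.59]
[cite: MorganTian2007, Def. 5.3] -/
theorem stub_transfer :
    ∀ (M : Type) [TopologicalSpace M] [T2Space M] [SecondCountableTopology M]
      [ChartedSpace (EuclideanSpace ℝ (Fin 4)) M] [IsManifold (𝓡 4) ∞ M] [ConnectedSpace M]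
      (N : Type) [TopologicalSpace N] [T2Space N] [SecondCountableTopology N]
      [ChartedSpace (EuclideanSpace ℝ (Fin 4)) N] [IsManifold (𝓡 4) ∞ N] [CompactSpace N] [Nonempty N]
      (h : PseudoRiemannianMetric (𝓡 4) ∞ (EuclideanSpace ℝ (Fin 4)) (TangentSpace (𝓡 4) : N → Type _))
      (k : ℝ), h.IsRiemannian → h.HasConstantSectionalCurvature k →
      ∀ (U : ℕ → Set N) (φ : ℕ → N → M), (∀ n, IsOpen (U n)) → Monotone U → (⋃ n, U n) = univ →
        (∀ n, IsLocalDiffeomorphOn (𝓡 4) (𝓡 4) ∞ (φ n) (U n)) → (∀ n, InjOn (φ n) (U n)) →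
        ∃ g' : PseudoRiemannianMetric (𝓡 4) ∞ (EuclideanSpace ℝ (Fin 4)) (TangentSpace (𝓡 4) : M → Type _),
          g'.IsRiemannian ∧ g'.HasConstantSectionalCurvature k := by
  intro M _ _ _ _ _ _ N _ _ _ _ _ _ _ h k hh hk U φ hUo hmono hcov hloc hinj
  -- (i) the exhaustion stabilises
  obtain ⟨n, hn⟩ := exists_eq_univ_of_monotone_iUnion_eq_univ hUo hmono hcov
  -- (ii) `φ n` is a bijective local diffeomorphism of all of `N`, hence a diffeomorphism
  have hφ : IsLocalDiffeomorph (𝓡 4) (𝓡 4) ∞ (φ n) := by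
    rw [isLocalDiffeomorph_iff_isLocalDiffeomorphOn_univ, ← hn]
    exact hloc n
  have hbij : Bijective (φ n) :=
    ⟨injOn_univ.mp (hn ▸ hinj n), surjective_of_isLocalDiffeomorph hφ⟩
  set Ψ : M ≃ₘ^∞⟮𝓡 4, 𝓡 4⟯ N := (hφ.diffeomorphOfBijective hbij).symm
  -- (iii) transport `h` along `Ψ = Φ⁻¹ : M → N`
  have hΨs : ContMDiff (𝓡 4) (𝓡 4) (∞ + 1) Ψ :=
    Ψ.contMDiff.of_le (by exact_mod_cast le_top)
  have hΨi : ∀ x, Injective (mfderiv (𝓡 4) (𝓡 4) Ψ x) := injective_mfderiv_diffeomorph Ψ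
  exact ⟨h.comap contMDiff_pullbackBilin_holds Ψ hΨs hΨi rfl,
    hh.comap contMDiff_pullbackBilin_holds hΨs hΨi rfl,
    hasConstantSectionalCurvature_comap h contMDiff_pullbackBilin_holds hΨs hΨi rfl hk⟩

end Summit.SmoothPoincare4.SmoothPoincare4.Theorems.MargerinRails

end
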